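import Summits.KontsevichZagierPeriods.KontsevichZagierPeriods.Theorems.LinRedNormalFormArrangementNormalFormStubRebaseSimplePosOnePosQuadForms

/-!
# Stub `stub_rebaseSimplePosOnePos` (crux `ArrangementNormalForm`, line `janus-bands`) —
part `QuadMove`: the steep blow-up of a flat point, the literal move (`B = 2`)

`B = 2` corner calculus, third file. A literal one-fibre datum over the base `(x₁, x₂, y)`
with base pole `y = 0`, letter `0`, LINEAR bounds `u < t < v` (through the origin), whose rows
are linear forms, forms in `x₁` alone or forms in `x₂` alone (`hM`), whose silent factors
`Lⱼ(x₁, x₂)` are linear or depend on ONE of `x₁`, `x₂` (`hL`: far factors parallel to an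
axis), over the steep sector piece `{rows, 0 < x₁ < x₂ < ε}` of the silent plane and inside a
cone `|y| ≤ K x₂` (`hK`), is moved by the chart `RebasePos.blowQ`
(`x₁ = ρ`, `x₂ = ρ/ξ`, `y = ρ η/ξ`, `t = ρ θ/ξ`, rule 2, Jacobian `ρ³/ξ⁴`) to a LITERAL datum of
the same kind over the base `(ρ, ξ, η)`: rows `RebasePos.chartRowQ`, bounds
`RebasePos.chartFQ u < θ < chartFQ v` (`ρ`-FREE, parallel in `η` with the same slope), base
pole `η = 0`, letter `0`, silent factors `RebasePos.chartLQ (Lⱼ)` (linear `a x₁ + b x₂ ↦ a ξ + b`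
with a factor `ρ/ξ`; `c + a x₁ ↦ c + a ρ`; `c + b x₂ ↦ c ξ + b ρ` with a factor `1/ξ`) plus
the two coordinate forms `ρ`, `ξ`, and numerator the `x₂`-homogenisation `RebasePos.homogQ p`
of `p` times a monomial in `ρ, ξ` (`RebasePos.quadBlowUpSteep`). The height of the `η`-range
and the width of the new band are forms in `ξ` alone, so the flat cells of the new datum have
DEPENDENT height and width (part `ParFlatDep`).

References: M. Kontsevich, D. Zagier, *Periods* (2001), §1.2, rule (2).
-/

noncomputable section

open Set MeasureTheory MvPolynomial
open Literature.NumberTheory.Transcendental Literature.ModelTheory.ExponentialFields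

namespace Summit.KontsevichZagierPeriods.ArrangementNormalForm.JanusBands

namespace RebasePos

open SeparatePos

section QuadMoveMain

variable {m m' : ℕ}

/-- Truncated subtraction of exponents: `x^{(a−b)⁺} x^b = x^{(b−a)⁺} x^a`. -/
theorem pow_tsub_mul_pow (x : ℝ) (a b : ℕ) : x ^ (a - b) * x ^ b = x ^ (b - a) * x ^ a := by
  rcases le_total a b with h | h
  · obtain ⟨c, rfl⟩ := Nat.exists_eq_add_of_le h
    rw [Nat.sub_eq_zero_of_le h, Nat.add_sub_cancel_left, pow_zero, one_mul, pow_add, mul_comm]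
  · obtain ⟨c, rfl⟩ := Nat.exists_eq_add_of_le h
    rw [Nat.sub_eq_zero_of_le h, Nat.add_sub_cancel_left, pow_zero, one_mul, pow_add, mul_comm]

/-- The chart rows and bounds bound the output domain. -/
theorem quad_out_bounds (ε : ℚ) (K : ℝ) (M' : Fin m' → (Fin (2 + 1) → ℚ) × ℚ) (U V : (Fin (2 + 1) → ℚ) × ℚ)
    (hU : U.1 0 = 0) (hV : V.1 0 = 0)
    (w : Fin (2 + 1 + 1) → ℝ)
    (hw : w ∈ gDom 2 1 (m' + 4) (Fin.append M' (outRowsQ ε)) (fun _ => Sum.inr U) (fun _ => Sum.inr V))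
    (hη : |w 2| ≤ K) :
    ∀ l, |w l| ≤ max (max (ε : ℝ) 1) (max K (max (|(U.1 1 : ℝ)| + |(U.1 2 : ℝ)| * K + |(U.2 : ℝ)|)
      (|(V.1 1 : ℝ)| + |(V.1 2 : ℝ)| * K + |(V.2 : ℝ)|))) := by
  rw [mem_gDom_append₂] at hw
  obtain ⟨⟨-, hbox⟩, hlo, hhi⟩ := hw
  obtain ⟨hρ, hξ, hξ1, hρε⟩ := outRowsQ_bounds ε w hbox
  have hK0 : 0 ≤ K := (abs_nonneg _).trans hη
  have hε : (0 : ℝ) < ε := pos_of_mul_pos_left (hρ.trans hρε) hξ.le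
  rw [affF_three, hU] at hlo
  rw [affF_three, hV] at hhi
  simp only [Rat.cast_zero, zero_mul, zero_add] at hlo hhi
  have hξa : |w 1| ≤ 1 := by rw [abs_of_pos hξ]; exact hξ1.le
  have h1 : |(U.1 1 : ℝ) * w 1| ≤ |(U.1 1 : ℝ)| := by
    rw [abs_mul]; exact (mul_le_mul_of_nonneg_left hξa (abs_nonneg _)).trans (mul_one _).le
  have h2 : |(U.1 2 : ℝ) * w 2| ≤ |(U.1 2 : ℝ)| * K := by
    rw [abs_mul]; exact mul_le_mul_of_nonneg_left hη (abs_nonneg _)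
  have h3 : |(V.1 1 : ℝ) * w 1| ≤ |(V.1 1 : ℝ)| := by
    rw [abs_mul]; exact (mul_le_mul_of_nonneg_left hξa (abs_nonneg _)).trans (mul_one _).le
  have h4 : |(V.1 2 : ℝ) * w 2| ≤ |(V.1 2 : ℝ)| * K := by
    rw [abs_mul]; exact mul_le_mul_of_nonneg_left hη (abs_nonneg _)
  have hlo' : -(|(U.1 1 : ℝ)| + |(U.1 2 : ℝ)| * K + |(U.2 : ℝ)|) ≤ w 3 := by
    have := neg_abs_le ((U.1 1 : ℝ) * w 1)
    have := neg_abs_le ((U.1 2 : ℝ) * w 2)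
    have := neg_abs_le (U.2 : ℝ)
    linarith
  have hhi' : w 3 ≤ |(V.1 1 : ℝ)| + |(V.1 2 : ℝ)| * K + |(V.2 : ℝ)| := by
    have := le_abs_self ((V.1 1 : ℝ) * w 1)
    have := le_abs_self ((V.1 2 : ℝ) * w 2)
    have := le_abs_self (V.2 : ℝ)
    linarith
  intro l
  fin_cases l
  · show |w 0| ≤ _
    rw [abs_of_pos hρ]
    refine le_trans ?_ ((le_max_left _ _).trans (le_max_left _ _))
    nlinarith
  · show |w 1| ≤ _
    exact hξa.trans ((le_max_right _ _).trans (le_max_left _ _))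
  · show |w 2| ≤ _
    exact hη.trans ((le_max_left _ _).trans (le_max_right _ _))
  · show |w 3| ≤ _
    refine le_trans ?_ ((le_max_right _ _).trans (le_max_right _ _))
    rw [abs_le]
    constructor
    · exact le_trans (neg_le_neg (le_max_left _ _)) hlo'
    · exact hhi'.trans (le_max_right _ _)

/-- **The steep blow-up of a flat point, literal move** (`B = 2`, rule 2 with `x₁ = ρ`,
`x₂ = ρ/ξ`, `y = ρ η/ξ`, `t = ρ θ/ξ`, Jacobian `ρ³/ξ⁴`). See the module docstring. Rows of the
three allowed kinds (`hM`), far silent factors parallel to an axis (`hL`), linear bounds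
(`hu`, `hv`), the domain inside the cone `|y| ≤ K x₂` (`hK`). -/
theorem quadBlowUpSteep (ε : ℚ) (K : ℝ) (s : KZ.IntegralRep (2 + 1 + 1)) (M : Fin m' → (Fin (2 + 1) → ℚ) × ℚ)
    (L : Fin m → (Fin 2 → ℚ) × ℚ) (e : Fin m → ℕ) (p : MvPolynomial (Fin 2) ℚ) (ℓ₁ : (Fin 2 → ℚ) × ℚ)
    (u v : (Fin (2 + 1) → ℚ) × ℚ)
    (hdom : s.domain = gDom 2 1 (m' + 4) (Fin.append M (boxRowsQ ε)) (fun _ => Sum.inr u) (fun _ => Sum.inr v))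
    (hint : EqOn s.integrand (glit 2 1 p L e ℓ₁ 0 0 1 (fun _ => some 0)) s.domain)
    (hM : ∀ j, (M j).2 ≠ 0 → ((M j).1 1 = 0 ∧ (M j).1 2 = 0) ∨ ((M j).1 0 = 0 ∧ (M j).1 2 = 0))
    (hL : ∀ j, (L j).2 ≠ 0 → (L j).1 1 ≠ 0 → (L j).1 0 = 0)
    (hu : u.2 = 0) (hv : v.2 = 0) (hK : ∀ z ∈ s.domain, |z 2| ≤ K * z 1) :
    ∃ s' : KZ.IntegralRep (2 + 1 + 1), Bornology.IsBounded s'.domain ∧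
      s'.domain = gDom 2 1 (m' + 4) (Fin.append (fun j => chartRowQ (M j)) (outRowsQ ε))
        (fun _ => Sum.inr (chartFQ u)) (fun _ => Sum.inr (chartFQ v)) ∧
      s'.integrand = glit 2 1 (chartPQ p L e) (chartLsQ L) (chartEsQ p L e) 0 0 0 1 (fun _ => some 0) ∧
      (∀ w, w ∈ s'.domain ↔ blowQ w ∈ s.domain) ∧
      KZ.of s - KZ.of s' ∈ KZ.relations := by
  set R := gDom 2 1 (m' + 4) (Fin.append (fun j => chartRowQ (M j)) (outRowsQ ε))
    (fun _ => Sum.inr (chartFQ u)) (fun _ => Sum.inr (chartFQ v)) with hR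
  have ht : ∀ w : Fin (2 + 1 + 1) → ℝ, w 0 * w 3 / w 1 = w 0 / w 1 * w 3 := fun w =>
    mul_div_right_comm _ _ _
  -- membership
  have hΨdom : ∀ w, w ∈ R ↔ blowQ w ∈ s.domain := fun w => by
    rw [hR, mem_gDom_append₂, hdom, mem_gDom_append₂, boxRowsQ_iff]
    constructor
    · rintro ⟨⟨hrow, hbox⟩, hlo, hhi⟩
      obtain ⟨hρ, hξ, -, -⟩ := outRowsQ_bounds ε w hbox
      have hq : 0 < w 0 / w 1 := div_pos hρ hξ
      refine ⟨⟨fun j => (affF_blowQ_pos_iff (M j) (hM j) w hρ hξ).2 (hrow j), hbox⟩, ?_, ?_⟩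
      · rw [affF_blowQ_lin u hu w hξ.ne', blowQ_three, ht]
        exact mul_lt_mul_of_pos_left hlo hq
      · rw [affF_blowQ_lin v hv w hξ.ne', blowQ_three, ht]
        exact mul_lt_mul_of_pos_left hhi hq
    · rintro ⟨⟨hrow, hbox⟩, hlo, hhi⟩
      obtain ⟨hρ, hξ, -, -⟩ := outRowsQ_bounds ε w hbox
      have hq : 0 < w 0 / w 1 := div_pos hρ hξ
      refine ⟨⟨fun j => (affF_blowQ_pos_iff (M j) (hM j) w hρ hξ).1 (hrow j), hbox⟩, ?_, ?_⟩
      · rw [affF_blowQ_lin u hu w hξ.ne', blowQ_three, ht] at hlo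
        exact lt_of_mul_lt_mul_left hlo hq.le
      · rw [affF_blowQ_lin v hv w hξ.ne', blowQ_three, ht] at hhi
        exact lt_of_mul_lt_mul_left hhi hq.le
  have hbR : ∀ w ∈ R, 0 < w 0 ∧ 0 < w 1 ∧ w 1 < 1 ∧ w 0 < ε * w 1 := fun w hw => by
    rw [hR, mem_gDom_append₂] at hw
    exact outRowsQ_bounds ε w hw.1.2
  have hxD : ∀ z ∈ s.domain, 0 < z 0 ∧ 0 < z 1 := fun z hz => by
    rw [hdom, mem_gDom_append₂] at hz
    obtain ⟨h0, h1, -, -⟩ := boxRowsQ_pos ε z hz.1.2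
    exact ⟨h0, h1⟩
  have himg : blowQ '' R = s.domain := by
    ext z
    constructor
    · rintro ⟨w, hw, rfl⟩
      exact (hΨdom w).1 hw
    · intro hz
      obtain ⟨h0, h1⟩ := hxD z hz
      exact ⟨blowQInv z, (hΨdom _).2 (by rw [blowQ_blowQInv z h0.ne' h1.ne']; exact hz),
        blowQ_blowQInv z h0.ne' h1.ne'⟩
  have hinj : InjOn blowQ R := injOn_blowQ fun w hw => ⟨(hbR w hw).1.ne', (hbR w hw).2.1.ne'⟩
  -- the integrand identity
  have hf : ∀ w ∈ R, glit 2 1 (chartPQ p L e) (chartLsQ L) (chartEsQ p L e) 0 0 0 1 (fun _ => some 0) w =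
      s.integrand (blowQ w) * |(blowQLin w).det| := by
    intro w hw
    obtain ⟨hρ, hξ, -, -⟩ := hbR w hw
    have hρ0 : w 0 ≠ 0 := hρ.ne'
    have hξ0 : w 1 ≠ 0 := hξ.ne'
    have h0 : affB 2 1 (0 : (Fin 2 → ℚ) × ℚ) w = 0 := by simp [affB_three]
    have h0' : affB 2 1 (0 : (Fin 2 → ℚ) × ℚ) (blowQ w) = 0 := by simp [affB_three]
    have harg : (fun i : Fin 2 => blowQ w (Fin.castSucc (Fin.castSucc i))) =
        fun i => (![w 0, w 0 / w 1] : Fin 2 → ℝ) i := by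
      funext i; fin_cases i <;> rfl
    have harg' : (fun i : Fin 2 => w (Fin.castSucc (Fin.castSucc i))) = fun i => (![w 0, w 1] : Fin 2 → ℝ) i := by
      funext i; fin_cases i <;> rfl
    have hprod : ∏ j, affB 2 1 (chartLsQ L j) w ^ chartEsQ p L e j =
        (∏ j, affB 2 1 (chartLQ (L j)) w ^ e j) * (w 0 ^ (expA L e - 1) * w 1 ^ (p.degreeOf 1 + 2 - expB L e)) := by
      rw [Fin.prod_univ_add]
      simp [chartLsQ, chartEsQ, Fin.prod_univ_two, affB_rhoQ, affB_xiQ]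
    rw [hint ((hΨdom w).1 hw), abs_blowQLin_det w hρ hξ, glit_three, glit_three, harg, harg', hprod,
      prod_affB_blowQ_eq L e hL w hρ0 hξ0, chartPQ, map_mul, map_mul, map_pow, map_pow, aeval_X, aeval_X,
      aeval_homogQ p w hξ0, h0, h0']
    simp only [blowQ_two, blowQ_three, Matrix.cons_val_zero, Matrix.cons_val_one, sub_zero]
    by_cases h2 : w 2 = 0
    · simp [h2]
    by_cases h3 : w 3 = 0
    · simp [h3]
    have hA := pow_tsub_mul_pow (w 0) 1 (expA L e)
    have hB := pow_tsub_mul_pow (w 1) (expB L e) (p.degreeOf 1 + 2)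
    rw [pow_one] at hA
    -- clear denominators; the truncated exponents enter through `hA`, `hB`
    set a1 := w 0 ^ (1 - expA L e) with ha1
    set a2 := w 0 ^ (expA L e - 1) with ha2
    set b1 := w 1 ^ (expB L e - (p.degreeOf 1 + 2)) with hb1
    set b2 := w 1 ^ (p.degreeOf 1 + 2 - expB L e) with hb2
    have ha2' : a2 ≠ 0 := pow_ne_zero _ hρ0
    have hb2' : b2 ≠ 0 := pow_ne_zero _ hξ0
    rcases eq_or_ne (∏ j, affB 2 1 (chartLQ (L j)) w ^ e j) 0 with hQ | hQ
    · rw [hQ]; simp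
    rw [inv_pow]
    field_simp
    linear_combination (w 1 ^ p.degreeOf 1 * w 1 ^ 2 *
        MvPolynomial.aeval (fun i : Fin 2 => (![w 0, w 0 / w 1] : Fin 2 → ℝ) i) p * b1) * hA +
      (MvPolynomial.aeval (fun i : Fin 2 => (![w 0, w 0 / w 1] : Fin 2 → ℝ) i) p * a2 * w 0) * hB
  have hRsa : IsSemialgebraic ℚ R := isSemialgebraic_gDom _ _ _ _
  obtain ⟨s', hd', hi', hrel⟩ := RebaseZero.cov_pull s hRsa blowQ blowQLin (isSemialgebraicMapOn_blowQ hRsa)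
    (fun w hw => (hasFDerivAt_blowQ w (hbR w hw).2.1.ne').hasFDerivWithinAt) hinj himg _
    (isSemialgebraicFunOn_glit hRsa _ _ _ _ _ _ _ _) hf
  refine ⟨s', ?_, hd', hi', fun w => by rw [hd']; exact hΨdom w, hrel⟩
  rw [hd']
  refine isBounded_of_forall_abs_le _ fun w hw => quad_out_bounds ε K _ (chartFQ u) (chartFQ v) rfl rfl w hw ?_
  -- `|η| ≤ K` from the cone condition at `blowQ w`
  have hz := (hΨdom w).1 hw
  obtain ⟨hρ, hξ, -, -⟩ := hbR w hw
  have h := hK _ hz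
  rw [blowQ_two, blowQ_one, abs_div, abs_mul, abs_of_pos hρ, abs_of_pos hξ] at h
  have hq : 0 < w 0 / w 1 := div_pos hρ hξ
  have h' : (w 0 / w 1) * |w 2| ≤ (w 0 / w 1) * K := by
    rw [show (w 0 / w 1) * |w 2| = w 0 * |w 2| / w 1 by ring, show (w 0 / w 1) * K = K * (w 0 / w 1) by ring]
    exact h
  exact le_of_mul_le_mul_left h' hq

end QuadMoveMain

end RebasePos

/-- **Registered part of `stub_rebaseSimplePosOnePos` (line `janus-bands`, `B = 2` corner
calculus): the steep blow-up of a flat point, literal move** (`RebasePos.quadBlowUpSteep`,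
rule 2 with `x₁ = ρ`, `x₂ = ρ/ξ`, `y = ρ η/ξ`, `t = ρ θ/ξ`, Jacobian `ρ³/ξ⁴`): the literal
one-fibre datum over the steep sector piece `{rows, 0 < x₁ < x₂ < ε, u < t < v}` at a flat
point at the origin (base pole `y = 0`, letter `0`, linear bounds, rows linear or in `x₁` / in
`x₂` alone, far silent factors parallel to an axis, domain in a cone `|y| ≤ K x₂`) is congruent
modulo `KZ.relations` to the literal datum over `{rows', ρ > 0, 0 < ξ < 1, ρ < ε ξ, U < θ < V}`
with `ρ`-free bounds `U, V` (same `η`-slope), base pole `η = 0`, letter `0`, charted silent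
factors and the homogenised numerator. -/
theorem rebaseSimplePos_quadBlowUpSteep (m m' : ℕ) (ε : ℚ) (K : ℝ) (s : KZ.IntegralRep (2 + 1 + 1)) (M : Fin m' → (Fin (2 + 1) → ℚ) × ℚ) (L : Fin m → (Fin 2 → ℚ) × ℚ) (e : Fin m → ℕ) (p : MvPolynomial (Fin 2) ℚ) (ℓ₁ : (Fin 2 → ℚ) × ℚ) (u v : (Fin (2 + 1) → ℚ) × ℚ) (hdom : s.domain = SeparatePos.gDom 2 1 (m' + 4) (Fin.append M (RebasePos.boxRowsQ ε)) (fun _ => Sum.inr u) (fun _ => Sum.inr v)) (hint : Set.EqOn s.integrand (RebasePos.glit 2 1 p L e ℓ₁ 0 0 1 (fun _ => some 0)) s.domain) (hM : ∀ j, (M j).2 ≠ 0 → ((M j).1 1 = 0 ∧ (M j).1 2 = 0) ∨ ((M j).1 0 = 0 ∧ (M j).1 2 = 0)) (hL : ∀ j, (L j).2 ≠ 0 → (L j).1 1 ≠ 0 → (L j).1 0 = 0) (hu : u.2 = 0) (hv : v.2 = 0) (hK : ∀ z ∈ s.domain, |z 2| ≤ K * z 1) : ∃ s' : KZ.IntegralRep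 (2 + 1 + 1), Bornology.IsBounded s'.domain ∧ s'.domain = SeparatePos.gDom 2 1 (m' + 4) (Fin.append (fun j => RebasePos.chartRowQ (M j)) (RebasePos.outRowsQ ε)) (fun _ => Sum.inr (RebasePos.chartFQ u)) (fun _ => Sum.inr (RebasePos.chartFQ v)) ∧ s'.integrand = RebasePos.glit 2 1 (RebasePos.chartPQ p L e) (RebasePos.chartLsQ L) (RebasePos.chartEsQ p L e) 0 0 0 1 (fun _ => some 0) ∧ (∀ w, w ∈ s'.domain ↔ RebasePos.blowQ w ∈ s.domain) ∧ KZ.of s - KZ.of s' ∈ KZ.relations :=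
  RebasePos.quadBlowUpSteep ε K s M L e p ℓ₁ u v hdom hint hM hL hu hv hK

end Summit.KontsevichZagierPeriods.ArrangementNormalForm.JanusBands
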